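import Summits.QuantumAdvantage.QuantumAdvantage.Theorems.CubicForrelationNearExactIsExactTwoModSixSecondCheapRank
import Summits.QuantumAdvantage.QuantumAdvantage.Theorems.CubicForrelationNearExactIsExactTwoModSixSecondDuality
import Summits.QuantumAdvantage.QuantumAdvantage.Theorems.CubicForrelationNearExactIsExactTwoModSixSecondTypeOLowRank

/-!
# Crux `CubicForrelation.NearExactIsExact` (stmt-QuantumAdvantage-14043) — `n = 6r+2`, type O with every point cheap against a type-O
  partner: the "wild" part `τ_g − (−1)^{d₁}` has `ℓ²`-mass `≥ 2ⁿ − 4` (`r ≥ 2`, uniform in `r`, includes `n = 14`)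

Certificate seat `b2b-cforr-cert` (gen 9).  HONEST FRAMING: a structural theorem about the residual "all-cheap" branch of the certified case list
at the second boundary (`second_boundary_side_two_mod_six`); NOT a kill of that branch, NOT summit progress.

Setting: `W_g = 2^{2r+1}u` with `u ≡ 2^r ± 1 (mod 8)` everywhere (then `d₁ = [⌊u/2⌋ odd]` is quadratic of rank `≤ 2`, `tm2_cheap_rank_le_two`,
and `τ_g := u − 2^r(−1)^f ≡ (−1)^{d₁} (mod 8)`), and a partner side `W_f = 2^{2r+1}v` with `v` odd everywhere (type O).
* `tm2_cheap_walsh_support` — the Walsh transform of `(−1)^{d₁}` vanishes outside at most `4` frequencies (`fp_card_supp_mul_le` with the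
  radical, `#rad ≥ 2^{6r}`).
* `tm2_cheap_wild_mass` — `Σ_x (τ_g(x) − (−1)^{d₁(x)})² ≥ 2ⁿ − 4`:  by the residual duality `W(τ_g) = −2^{3r+1}τ_f` (`tm2_residual_dual`),
  off those `≤ 4` frequencies `W(τ_g − (−1)^{d₁})(y) = −2^{3r+1}τ_f(y)` with `τ_f(y) = v(y) − 2^r(−1)^{g(y)}` ODD, so Parseval gives
  `2ⁿ·Σ(τ_g − (−1)^{d₁})² ≥ (2ⁿ − 4)·2^{6r+2}`.  Since every summand is `≡ 0 (mod 8)`, the wild set `{τ_g ≠ (−1)^{d₁}} = {|τ_g| ≥ 7}` carries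
  `Σ_{wild} ((τ_g − (−1)^{d₁})/8)² ≥ (2ⁿ − 4)/64`, while the budget `Στ_g² ≤ 2·2ⁿ` at `Φ ≥ 1 − 2^{−2r}` caps it (see the seat write-up).

References: C. Carlet (2021) §2.3; MacWilliams–Sloane (1977) Ch. 15 §2.  Everything below is proved from the tree; axioms are the standard three.
-/

set_option linter.dupNamespace false -- D-0017: single-problem summit ⇒ `QuantumAdvantage.QuantumAdvantage` by design

noncomputable section

namespace Summit.QuantumAdvantage.QuantumAdvantage.Theorems.CubicForrelation.NearExactIsExact

open Finset
open Literature.Computability.QuantumComplexity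
open Literature.Computability.QuantumComplexity.BuzetChailloux (bxor zeroVec bxor_zeroVec zeroVec_bxor bxor_comm)
open Literature.Computability.QuantumComplexity.DerivativeWalsh (W)

/-- **At most four frequencies.**  For cubic `g` on `6r+2` bits with `W_g = 2^{2r+1}u` and every point cheap (`u ≡ 2^r ± 1 (mod 8)`, `r ≥ 2`),
the Walsh transform of the first-digit sign `(−1)^{[⌊u/2⌋ odd]}` is non-zero at no more than `4` points. [this work] -/
theorem tm2_cheap_walsh_support (r : ℕ) (hr : 2 ≤ r) (g : (Fin ((3 * r + 1) + (3 * r + 1)) → Bool) → Bool)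
    (u : (Fin ((3 * r + 1) + (3 * r + 1)) → Bool) → ℤ) (hg : IsDegLeFun 3 g)
    (hu : ∀ x, W (fun y => signOf (g y)) x = (2 : ℝ) ^ (2 * r + 1) * (u x : ℝ))
    (hcheap : ∀ x, (8 : ℤ) ∣ u x - 2 ^ r - 1 ∨ (8 : ℤ) ∣ u x - 2 ^ r + 1) :
    #(univ.filter fun y : Fin ((3 * r + 1) + (3 * r + 1)) → Bool =>
      W (fun x => signOf (decide (Odd (u x / 2)))) y ≠ 0) ≤ 4 := by
  classical
  have h4 : (2 : ℤ) ^ r = 4 * 2 ^ (r - 2) := by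
    rw [show (4 : ℤ) = 2 ^ 2 by norm_num, ← pow_add]; congr 1; omega
  have hodd : ∀ x, Odd (u x) := by
    intro x
    rw [Int.odd_iff]
    rcases hcheap x with h | h <;> omega
  have hd1 : IsDegLeFun 2 (fun x => decide (Odd (u x / 2))) := tm2_digitOne r g u hg hu hodd
  have hRcard := tm2_cheap_rank_le_two r hr g u hg hu hcheap
  set R := univ.filter (fun a : Fin ((3 * r + 1) + (3 * r + 1)) → Bool => ∀ b,
      (decide (Odd (u zeroVec / 2)) ^^ decide (Odd (u a / 2)) ^^ decide (Odd (u b / 2)) ^^ decide (Odd (u (bxor a b) / 2))) = false)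
    with hRdef
  have h0R : zeroVec ∈ R := by
    refine mem_filter.2 ⟨mem_univ _, fun b => ?_⟩
    rw [zeroVec_bxor]
    cases decide (Odd (u zeroVec / 2)) <;> cases decide (Odd (u b / 2)) <;> rfl
  have haddR : ∀ a ∈ R, ∀ a' ∈ R, bxor a a' ∈ R := by
    intro a ha a' ha'
    refine mem_filter.2 ⟨mem_univ _, fun b => ?_⟩
    rw [es_B_add_left (fun x => decide (Odd (u x / 2))) hd1 a a' b, (mem_filter.1 ha).2 b, (mem_filter.1 ha').2 b]
    rfl
  have hDR : ∀ a ∈ R, ∀ x : Fin ((3 * r + 1) + (3 * r + 1)) → Bool,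
      decide (Odd (u (bxor x a) / 2)) = (decide (Odd (u x / 2)) ^^ (decide (Odd (u zeroVec / 2)) ^^ decide (Odd (u a / 2)))) := by
    intro a ha x
    have h := (mem_filter.1 ha).2 x
    rw [bxor_comm] at h
    revert h
    cases decide (Odd (u zeroVec / 2)) <;> cases decide (Odd (u a / 2)) <;> cases decide (Odd (u x / 2)) <;>
      cases decide (Odd (u (bxor x a) / 2)) <;> decide
  have hsupp := fp_card_supp_mul_le (fun x => signOf (decide (Odd (u x / 2)))) R h0R haddR (fun a ha => by
      refine ⟨signOf (decide (Odd (u zeroVec / 2)) ^^ decide (Odd (u a / 2))), ?_, fun x => ?_⟩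
      · unfold signOf; split_ifs <;> simp
      · rw [hDR a ha x, signOf_xor]; ring)
  have hN : (2 : ℕ) ^ ((3 * r + 1) + (3 * r + 1)) = 4 * 2 ^ (6 * r) := by
    rw [show (3 * r + 1) + (3 * r + 1) = 6 * r + 2 by ring, pow_add]; ring
  rw [hN] at hsupp
  have h1 := (Nat.mul_le_mul_left _ hRcard).trans hsupp
  exact Nat.le_of_mul_le_mul_right h1 (by positivity)

/-- **Wild mass in the all-cheap branch against a type-O partner** (`n = 6r+2`, `r ≥ 2`).  For cubic `g` with `W_g = 2^{2r+1}u`, every point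
cheap, and a partner `f` with `W_f = 2^{2r+1}v`, `v` odd everywhere:  `Σ_x (u(x) − 2^r(−1)^{f(x)} − (−1)^{d₁(x)})² ≥ 2ⁿ − 4`.  Uniform in `r`;
NOT a kill of the branch, NOT summit progress. [this work] -/
theorem tm2_cheap_wild_mass (r : ℕ) (hr : 2 ≤ r) (f g : (Fin ((3 * r + 1) + (3 * r + 1)) → Bool) → Bool) (hg : IsDegLeFun 3 g)
    (u v : (Fin ((3 * r + 1) + (3 * r + 1)) → Bool) → ℤ)
    (hu : ∀ x, W (fun y => signOf (g y)) x = (2 : ℝ) ^ (2 * r + 1) * (u x : ℝ))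
    (hv : ∀ y, W (fun x => signOf (f x)) y = (2 : ℝ) ^ (2 * r + 1) * (v y : ℝ)) (hvodd : ∀ y, Odd (v y))
    (hcheap : ∀ x, (8 : ℤ) ∣ u x - 2 ^ r - 1 ∨ (8 : ℤ) ∣ u x - 2 ^ r + 1) :
    (2 : ℝ) ^ ((3 * r + 1) + (3 * r + 1)) - 4 ≤
      ∑ x, ((u x : ℝ) - (2 : ℝ) ^ r * signOf (f x) - signOf (decide (Odd (u x / 2)))) ^ 2 := by
  classical
  have hsupp := tm2_cheap_walsh_support r hr g u hg hu hcheap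
  set ε : (Fin ((3 * r + 1) + (3 * r + 1)) → Bool) → ℝ := fun x => signOf (decide (Odd (u x / 2))) with hε
  set Y := univ.filter (fun y : Fin ((3 * r + 1) + (3 * r + 1)) → Bool => W ε y ≠ 0) with hYdef
  set D : (Fin ((3 * r + 1) + (3 * r + 1)) → Bool) → ℝ := fun x => (u x : ℝ) - (2 : ℝ) ^ r * signOf (f x) - ε x with hD
  -- `W(D) = −2^{3r+1} τ_f − W(ε)`
  have hWD : ∀ y, W D y = -(2 : ℝ) ^ (3 * r + 1) * ((v y : ℝ) - (2 : ℝ) ^ r * signOf (g y)) - W ε y := by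
    intro y
    have e : D = fun x => ((u x : ℝ) - (2 : ℝ) ^ r * signOf (f x)) + (-1) * ε x := by
      funext x; simp only [D]; ring
    rw [e, sp_W_add, fl1_W_smul, tm2_residual_dual r f g u v hu hv y]; ring
  -- off `Y` the transform is `−2^{3r+1}·(odd)`, of square `≥ 2^{6r+2}`
  have hoff : ∀ y, y ∉ Y → (2 : ℝ) ^ (6 * r + 2) ≤ W D y ^ 2 := by
    intro y hy
    have h0 : W ε y = 0 := by
      by_contra h
      exact hy (mem_filter.2 ⟨mem_univ _, h⟩)
    have hodd' : Odd (v y - 2 ^ r * sZ (g y)) := by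
      obtain ⟨t, rfl⟩ : ∃ t, r = t + 1 := ⟨r - 1, by omega⟩
      exact Int.odd_sub.2 (iff_of_true (hvodd y) (by rw [pow_succ]; exact ⟨2 ^ t * sZ (g y), by ring⟩))
    have h1 : (1 : ℤ) ≤ (v y - 2 ^ r * sZ (g y)) ^ 2 := by
      have h0' := Int.odd_iff.1 hodd'
      have : v y - 2 ^ r * sZ (g y) ≤ -1 ∨ 1 ≤ v y - 2 ^ r * sZ (g y) := by omega
      have := tp_sq_ge (k := 1) (by norm_num) this
      linarith
    have h1r : (1 : ℝ) ≤ ((v y : ℝ) - (2 : ℝ) ^ r * signOf (g y)) ^ 2 := by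
      have e : ((v y : ℝ) - (2 : ℝ) ^ r * signOf (g y)) = (((v y - 2 ^ r * sZ (g y) : ℤ)) : ℝ) := by
        push_cast; rw [tp_sZ_cast]
      rw [e]; exact_mod_cast h1
    rw [hWD y, h0, sub_zero, mul_pow, neg_pow_two, ← pow_mul, show (3 * r + 1) * 2 = 6 * r + 2 by ring]
    nlinarith [pow_pos (show (0 : ℝ) < 2 by norm_num) (6 * r + 2)]
  -- Parseval and the count of `Y`
  have hP := DerivativeWalsh.sum_W_sq D
  have hsplit := sum_filter_add_sum_filter_not univ (fun y : Fin ((3 * r + 1) + (3 * r + 1)) → Bool => W ε y ≠ 0)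
    (fun y => W D y ^ 2)
  have hYc : #(univ.filter fun y : Fin ((3 * r + 1) + (3 * r + 1)) → Bool => ¬ W ε y ≠ 0) + #Y =
      2 ^ ((3 * r + 1) + (3 * r + 1)) := by
    rw [hYdef, add_comm, card_filter_add_card_filter_not, card_univ, Fintype.card_fun, Fintype.card_bool, Fintype.card_fin]
  have hlow : ((2 : ℝ) ^ ((3 * r + 1) + (3 * r + 1)) - 4) * (2 : ℝ) ^ (6 * r + 2) ≤ ∑ y, W D y ^ 2 := by
    rw [← hsplit]
    have hA : 0 ≤ ∑ y ∈ univ.filter (fun y : Fin ((3 * r + 1) + (3 * r + 1)) → Bool => W ε y ≠ 0), W D y ^ 2 :=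
      sum_nonneg fun y _ => sq_nonneg _
    have hB : (#(univ.filter fun y : Fin ((3 * r + 1) + (3 * r + 1)) → Bool => ¬ W ε y ≠ 0) : ℝ) * (2 : ℝ) ^ (6 * r + 2) ≤
        ∑ y ∈ univ.filter (fun y : Fin ((3 * r + 1) + (3 * r + 1)) → Bool => ¬ W ε y ≠ 0), W D y ^ 2 := by
      rw [← nsmul_eq_mul, ← sum_const]
      exact sum_le_sum fun y hy => hoff y (fun hyY => (mem_filter.1 hy).2 (mem_filter.1 hyY).2)
    have hcnt : (2 : ℝ) ^ ((3 * r + 1) + (3 * r + 1)) - 4 ≤ #(univ.filter fun y : Fin ((3 * r + 1) + (3 * r + 1)) → Bool => ¬ W ε y ≠ 0) := by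
      have e : (#(univ.filter fun y : Fin ((3 * r + 1) + (3 * r + 1)) → Bool => ¬ W ε y ≠ 0) : ℝ) + #Y =
          (2 : ℝ) ^ ((3 * r + 1) + (3 * r + 1)) := by exact_mod_cast hYc
      have hY4 : (#Y : ℝ) ≤ 4 := by exact_mod_cast hsupp
      linarith
    nlinarith [pow_pos (show (0 : ℝ) < 2 by norm_num) (6 * r + 2)]
  rw [hP, show (6 * r + 2) = (3 * r + 1) + (3 * r + 1) by ring] at hlow
  rw [mul_comm] at hlow
  exact le_of_mul_le_mul_left hlow (by positivity)

end Summit.QuantumAdvantage.QuantumAdvantage.Theorems.CubicForrelation.NearExactIsExact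

end
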